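import Literature.RingTheory.CompleteLocalRings.ChainRingFrobeniusCharacter
import Literature.NumberTheory.GaloisCohomology.Howard2004.DVRLevelSelmerFiniteProofs
import Literature.NumberTheory.GaloisCohomology.Howard2004.DVRSettingPiRefinementResidual
import Literature.NumberTheory.GaloisCohomology.Howard2004.DualityDatumTateDualBijective
import HarnessLib

/-!
# Howard 2004, H.4 / §2.1 on a `DVRSetting`: the Frobenius character of every level ring `R_k = R/𝔪^{e_k}`
# and of every `R/π^j`, and `Θ : Tw(T^{(k)}) ⥲ Hom(T^{(k)}, μ_{p^k'})` bijective at EVERY level (proofs file)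

Topic `NumberTheory/GaloisCohomology/Howard2004` (sequel to `RingTheory/CompleteLocalRings/ChainRingFrobeniusCharacter`
and `DualityDatumTateDualBijective`).  THEOREMS ONLY: no definition, no named fact, no instance, no notation, no `sorry`.

B. Howard, *The Heegner point Kolyvagin system*, Compositio Math. 140 (2004) = arXiv:1202.6340: H.4 (p. 7 L69–82, the
`R(1)`-valued self-duality `T × Tw(T) → R(1)`) and §2.1 (p. 13 L20–24, «`Hom_{S_𝔭}(N, 𝒟_𝔭(1)) ≅ Hom_{ℤ_p}(N, μ_{p^∞})`»):
the `R`-linear dual and the Pontryagin/Tate dual of a finite free module over a finite quotient of a DVR agree.  In the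
tree this identification is `DualityDatum.toTateDual λ exp : Tw(T) → Hom(T, μ_{p^k'})`, bijective
(`toTateDual_bijective`) under the DUALIZING property `hlamb` of the character `λ : R → ℤ/p^{k'}`.  The cell's
reading files (`RelaxedSelmerSelfAnnihilatorProofs`, `…LagrangianCountProofs`, `DualityDatumLocalTwoSocleProofs`,
`UnramifiedSelfOrthogonalReadout`) obtained it from a dualizing FAMILY, i.e. from `(R, +) ≅ (ℤ/p^k)^ι` — true for the
Eisenstein frames' levels `Λ/(T^m + p, p^k)` but FALSE for the refined levels `R/π^{i+1}` of a ramified `R` (FINDING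
«READ-NONFREE», cell `pub/bsd-print-x9`, 2026-08-29).  Here it is derived for EVERY level with NO freeness hypothesis on
the ring, from «finite chain rings are Frobenius» (`exists_addMonoidHom_zmod_bijective_mul_compr₂`):

* §1 generic: **`DualityDatum.exists_toTateDual_bijective_of_isPrincipal`** — for a datum `D` over a FINITE local ring
  `A` with principal maximal ideal, `T` free of finite rank over `A`, `p^{k'} · A = 0` and a bijective trivialisation
  `exp : ℤ/p^{k'} ≅ μ_{p^{k'}}`: `∃ λ (hλ : ℤ_p-semilinear), Θ_λ = D.toTateDual λ hλ exp hexp` is BIJECTIVE.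
* §2 the level rings `R_k` of a `DVRSetting` with H.0–H.5: `natCast_pow_smul_levelRing_eq_zero` (`p^{k'} · R_k = 0` once
  `p^{k'} ∈ 𝔪^{e_k}`, e.g. `k' ≥ e_k`), `isPrincipal_maximalIdeal_levelRing`, **`exists_frobeniusCharacter_levelRing`**,
  **`exists_toTateDual_bijective_level`** (for `S.D k` on `T^{(k)}`).
* §3 the rings `R/π^j` (`S.QuotRing j`, `1 ≤ j`; the refined levels are `j = i+1`): `finite_quotRing`,
  `natCast_pow_smul_quotRing_eq_zero`, **`exists_frobeniusCharacter_quotRing`** — whence §1 applies verbatim to every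
  level datum `Dj` of `PiAdicRefinementDualityDatumProofs.exists_dualityDatum_modIdeal` / to `(S.refine hy pins).D i`.

Cell `pub/bsd-print-x9`, G87 = Howard 2004 Thm. 1.6.1 (print leaf `stub_h161` of stmt-BirchSwinnertonDyer-22642); seat
`bsd-line-x10b-p1-w6` g9, brick (FROB-CHAR) part 2 = (F4), LEAD g12 ruling 2026-08-29T06:08:59Z.  BSD is not proved by any
of this.

References: [Howard2004HeegnerKolyvagin] §1.3 H.4, §2.1 (arXiv:1202.6340 p. 7 L69–82, p. 13 L20–24);
[Wood1999DualityCodesFiniteRings] Thm. 3.10; [MilneADT2006] I §2 (`M^D = Hom(M, μ)`).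
-/

set_option autoImplicit false

noncomputable section

open Function NumberField IsDedekindDomain Field
open scoped NumberField ContRepresentation

namespace Literature.NumberTheory.GaloisCohomology.Howard2004

open Literature.NumberTheory.GaloisRepresentations
open Literature.NumberTheory.GaloisRepresentations.DiscreteGaloisModule
open Literature.RingTheory.CompleteLocalRings

/-! ## §1 Generic: `Θ` bijective over a finite chain ring -/

namespace DualityDatum

variable {K : Type} [Field K] [NumberField K] {M : Type} [AddCommGroup M] [TopologicalSpace M]
  [DiscreteTopology M] {A : Type} [CommRing A] [Module A M] [TopologicalSpace A] [DiscreteTopology A]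
  {p : ℕ} [Fact p.Prime] [Algebra ℤ_[p] A] {cd : ConjugationDatum K} {ρ : DiscreteGaloisModule K M}

/-- **`Θ : Tw(T) ⥲ Hom(T, μ_{p^{k'}})` for a datum over a FINITE CHAIN RING** (finite local `A`, principal maximal
ideal — every `R/𝔪^e`, every `R/π^j` — `T` free of finite rank, `p^{k'} · A = 0`, `exp` bijective): there is an
additive `λ : A → ℤ/p^{k'}`, automatically `ℤ_p`-semilinear, with `D.toTateDual λ _ exp hexp` BIJECTIVE (Frobenius
character, `exists_addMonoidHom_zmod_bijective_mul_compr₂` + `bijective_comp_linearMap_of_free` = the binder `hlamb` of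
`toTateDual_bijective`). [cite: Howard2004HeegnerKolyvagin, §1.3 H.4 and §2.1 (arXiv:1202.6340 p. 13 L20–24)] [cite: Wood1999DualityCodesFiniteRings, Thm. 3.10] -/
theorem exists_toTateDual_bijective_of_isPrincipal [IsLocalRing A] [Finite A] [Finite M] [Module.Free A M]
    [Module.Finite A M] (D : DualityDatum p cd ρ A) (hprinc : (IsLocalRing.maximalIdeal A).IsPrincipal) {k' : ℕ}
    (hk' : ∀ a : A, p ^ k' • a = 0) (exp : ZMod (p ^ k') →+ MuCarrier K (p ^ k'))
    (hexp : ∀ (g : absoluteGaloisGroup K) (x : ZMod (p ^ k')),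
      exp (cyclotomicCharacterModPow K p k' g * x) = mu K (p ^ k') g (exp x))
    (hexpb : Bijective exp) :
    ∃ (lam : A →+ ZMod (p ^ k'))
      (hlam : ∀ (z : ℤ_[p]) (a : A), lam (algebraMap ℤ_[p] A z * a) = PadicInt.toZModPow k' z * lam a),
      Bijective (D.toTateDual lam hlam exp hexp) := by
  haveI : NeZero (p ^ k') := ⟨pow_ne_zero _ (Fact.out : p.Prime).ne_zero⟩
  obtain ⟨lam, hbij⟩ := exists_addMonoidHom_zmod_bijective_mul_compr₂ (R := A) hprinc hk'
  exact ⟨lam, apply_algebraMap_mul_eq_toZModPow_mul hk' lam,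
    D.toTateDual_bijective lam _ exp hexp hexpb (bijective_comp_linearMap_of_free lam hbij)⟩

end DualityDatum

/-! ## §2 The level rings `R_k = R/𝔪^{e_k}` of a `DVRSetting` -/

section DVR

variable {p : ℕ} [Fact p.Prime] {K : Type} [Field K] [NumberField K]
  {R : Type} [CommRing R] [IsDomain R] [IsDiscreteValuationRing R] [Algebra ℤ_[p] R]
  {N : ℕ → Type} [∀ k, AddCommGroup (N k)] [∀ k, TopologicalSpace (N k)]
  [∀ k, DiscreteTopology (N k)] [∀ k, Module R (N k)]
  {Rk : ℕ → Type} [∀ k, CommRing (Rk k)] [∀ k, IsLocalRing (Rk k)] [∀ k, TopologicalSpace (Rk k)]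
  [∀ k, DiscreteTopology (Rk k)] [∀ k, Algebra ℤ_[p] (Rk k)] [∀ k, Algebra R (Rk k)]
  [∀ k, Module (Rk k) (N k)] [∀ k, IsScalarTower R (Rk k) (N k)]
  {Nbar : Type} [AddCommGroup Nbar] [TopologicalSpace Nbar] [DiscreteTopology Nbar]
  [∀ k, Module (Rk k) Nbar]
  {Nq : ℕ → Finset (HeightOneSpectrum (𝓞 K)) → Type} [∀ k n, AddCommGroup (Nq k n)]
  [∀ k n, TopologicalSpace (Nq k n)] [∀ k n, DiscreteTopology (Nq k n)]
  [∀ k n, Module (Rk k) (Nq k n)] [∀ k n, Module R (Nq k n)]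
  [∀ k n, IsScalarTower R (Rk k) (Nq k n)]

namespace DVRSetting

/-- `p^{k'} · R_k = 0` as soon as `p^{k'} ∈ 𝔪^{e_k}` (the kernel of `R → R_k`).
[cite: Howard2004HeegnerKolyvagin, §1.6 (arXiv:1202.6340 p. 11 L13–17, L33–34)] -/
theorem natCast_pow_smul_levelRing_eq_zero (S : DVRSetting p K R N Rk Nbar Nq) (hy : S.SatisfiesH) (k : ℕ)
    {k' : ℕ} (hk' : ((p : ℕ) : R) ^ k' ∈ IsLocalRing.maximalIdeal R ^ S.e k) (r : Rk k) :
    p ^ k' • r = 0 := by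
  have h0 : algebraMap R (Rk k) (((p : ℕ) : R) ^ k') = 0 := by
    rw [← RingHom.mem_ker, hy.ker_algebraMap k]
    exact hk'
  rw [nsmul_eq_mul, Nat.cast_pow, ← map_natCast (algebraMap R (Rk k)), ← map_pow, h0, zero_mul]

/-- `p^{e_k} ∈ 𝔪^{e_k}` (`p ∈ 𝔪`), so `k' = e_k` (or any `k' ≥ e_k`) is admissible in the previous lemma.
[cite: Howard2004HeegnerKolyvagin, §1 conventions and §1.6 (arXiv:1202.6340 p. 4 L47–52, p. 11 L13–17)] -/
theorem natCast_pow_mem_maximalIdeal_pow_of_le (S : DVRSetting p K R N Rk Nbar Nq) (hy : S.SatisfiesH) {k k' : ℕ}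
    (hkk' : S.e k ≤ k') : ((p : ℕ) : R) ^ k' ∈ IsLocalRing.maximalIdeal R ^ S.e k :=
  Ideal.pow_le_pow_right hkk' (Ideal.pow_mem_pow (S.natCast_p_mem_maximalIdeal hy) k')

/-- The maximal ideal of the level ring `R_k` is principal (generated by the image of `π`).
[cite: Howard2004HeegnerKolyvagin, §1.6 (arXiv:1202.6340 p. 11 L33–34)] -/
theorem isPrincipal_maximalIdeal_levelRing (S : DVRSetting p K R N Rk Nbar Nq) (hy : S.SatisfiesH) (k : ℕ) :
    (IsLocalRing.maximalIdeal (Rk k)).IsPrincipal :=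
  ⟨algebraMap R (Rk k) S.π, by rw [S.maximalIdeal_levelRing hy k, Ideal.submodule_span_eq]⟩

/-- **The level ring `R_k = R/𝔪^{e_k}` is Frobenius**: for `p^{k'} ∈ 𝔪^{e_k}` there is an additive character
`λ : R_k → ℤ/p^{k'}` with `r ↦ λ(r ·) : R_k → Hom(R_k, ℤ/p^{k'})` bijective — at EVERY level, with no freeness of
`(R_k, +)` over `ℤ/p^{k'}`. [cite: Howard2004HeegnerKolyvagin, §2.1 (arXiv:1202.6340 p. 13 L20–24)] [cite: Wood1999DualityCodesFiniteRings, Thm. 3.10] -/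
theorem exists_frobeniusCharacter_levelRing (S : DVRSetting p K R N Rk Nbar Nq) (hy : S.SatisfiesH) (k : ℕ)
    {k' : ℕ} (hk' : ((p : ℕ) : R) ^ k' ∈ IsLocalRing.maximalIdeal R ^ S.e k) :
    ∃ lam : Rk k →+ ZMod (p ^ k'), Bijective ((AddMonoidHom.mul : Rk k →+ Rk k →+ Rk k).compr₂ lam) := by
  haveI : NeZero (p ^ k') := ⟨pow_ne_zero _ (Fact.out : p.Prime).ne_zero⟩
  haveI : Finite (Rk k) := S.finite_coeffLevel hy k
  exact exists_addMonoidHom_zmod_bijective_mul_compr₂ (S.isPrincipal_maximalIdeal_levelRing hy k)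
    (S.natCast_pow_smul_levelRing_eq_zero hy k hk')

/-- **`Θ : Tw(T^{(k)}) ⥲ Hom(T^{(k)}, μ_{p^{k'}})` is bijective at EVERY level of a `DVRSetting`** with H.0–H.5, for
the H.4 datum `S.D k`, any `p^{k'} ∈ 𝔪^{e_k}` and any bijective equivariant trivialisation `exp : ℤ/p^{k'} ≅ μ_{p^{k'}}`:
`∃ λ hλ, Bijective ((S.D k).toTateDual λ hλ exp hexp)` — the binders `lam, hlam, hΘ` of the reading files, discharged.
[cite: Howard2004HeegnerKolyvagin, §1.3 H.4 and §2.1 (arXiv:1202.6340 p. 7 L69–82, p. 13 L20–24)] -/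
theorem exists_toTateDual_bijective_level (S : DVRSetting p K R N Rk Nbar Nq) (hy : S.SatisfiesH) (k : ℕ)
    {k' : ℕ} (hk' : ((p : ℕ) : R) ^ k' ∈ IsLocalRing.maximalIdeal R ^ S.e k)
    (exp : ZMod (p ^ k') →+ MuCarrier K (p ^ k'))
    (hexp : ∀ (g : absoluteGaloisGroup K) (x : ZMod (p ^ k')),
      exp (cyclotomicCharacterModPow K p k' g * x) = mu K (p ^ k') g (exp x))
    (hexpb : Bijective exp) :
    haveI : Finite (N k) := S.finite_level hy k
    ∃ (lam : Rk k →+ ZMod (p ^ k'))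
      (hlam : ∀ (z : ℤ_[p]) (a : Rk k), lam (algebraMap ℤ_[p] (Rk k) z * a) = PadicInt.toZModPow k' z * lam a),
      Bijective ((S.D k).toTateDual lam hlam exp hexp) := by
  haveI : Finite (Rk k) := S.finite_coeffLevel hy k
  haveI : Finite (N k) := S.finite_level hy k
  haveI : Module.Free (Rk k) (N k) := (hy.h0 k).1
  haveI : Module.Finite (Rk k) (N k) := Module.finite_of_finrank_eq_succ (hy.h0 k).2
  exact (S.D k).exists_toTateDual_bijective_of_isPrincipal (S.isPrincipal_maximalIdeal_levelRing hy k)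
    (S.natCast_pow_smul_levelRing_eq_zero hy k hk') exp hexp hexpb

/-! ## §3 The rings `R/π^j` (the refined levels `j = i + 1`) -/

/-- `R/π^j` is finite (`R` a coefficient ring: finite residue field; `(π^j) = 𝔪^j`).
[cite: Howard2004HeegnerKolyvagin, §1 conventions and §1.6 (arXiv:1202.6340 p. 4 L47–52, p. 11 L33–34)] -/
theorem finite_quotRing (S : DVRSetting p K R N Rk Nbar Nq) (hy : S.SatisfiesH) (j : ℕ) : Finite (S.QuotRing j) := by
  haveI : Finite (IsLocalRing.ResidueField R) := hy.coeffRing.finite_residueField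
  haveI : Finite (R ⧸ IsLocalRing.maximalIdeal R ^ j) := CompleteLocalRing.finite_quotient_maximalIdeal_pow j
  have h : IsLocalRing.maximalIdeal R ^ j = Ideal.span {S.π ^ j} := by rw [hy.unif, Ideal.span_singleton_pow]
  exact Finite.of_equiv _ (Ideal.quotEquivOfEq h).toEquiv

/-- `p^{k'} · (R/π^j) = 0` as soon as `p^{k'} ∈ (π^j)` (e.g. `k' ≥ j`, `natCast_p_pow_mem_span_pi_pow`).
[cite: Howard2004HeegnerKolyvagin, §1.6 (arXiv:1202.6340 p. 11 L13–14, L33–34)] -/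
theorem natCast_pow_smul_quotRing_eq_zero (S : DVRSetting p K R N Rk Nbar Nq) {j k' : ℕ}
    (hk' : ((p : ℕ) : R) ^ k' ∈ Ideal.span {S.π ^ j}) (r : S.QuotRing j) : p ^ k' • r = 0 := by
  have h0 : Ideal.Quotient.mk (Ideal.span {S.π ^ j}) (((p : ℕ) : R) ^ k') = 0 :=
    Ideal.Quotient.eq_zero_iff_mem.2 hk'
  rw [nsmul_eq_mul, Nat.cast_pow, ← map_natCast (Ideal.Quotient.mk (Ideal.span {S.π ^ j})), ← map_pow, h0,
    zero_mul]

/-- **`R/π^j` is Frobenius** (`1 ≤ j`, `p^{k'} ∈ (π^j)`): an additive `λ : R/π^j → ℤ/p^{k'}` with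
`r ↦ λ(r ·) : R/π^j → Hom(R/π^j, ℤ/p^{k'})` bijective — in particular at every REFINED level `R/π^{i+1}`, where
`(R/π^{i+1}, +)` need not be free over any `ℤ/p^k`. [cite: Howard2004HeegnerKolyvagin, §2.1 (arXiv:1202.6340 p. 13 L20–24)] [cite: Wood1999DualityCodesFiniteRings, Thm. 3.10] -/
theorem exists_frobeniusCharacter_quotRing (S : DVRSetting p K R N Rk Nbar Nq) (hy : S.SatisfiesH) {j : ℕ}
    (hj : 1 ≤ j) {k' : ℕ} (hk' : ((p : ℕ) : R) ^ k' ∈ Ideal.span {S.π ^ j}) :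
    ∃ lam : S.QuotRing j →+ ZMod (p ^ k'),
      Bijective ((AddMonoidHom.mul : S.QuotRing j →+ S.QuotRing j →+ S.QuotRing j).compr₂ lam) := by
  haveI : NeZero (p ^ k') := ⟨pow_ne_zero _ (Fact.out : p.Prime).ne_zero⟩
  haveI : Finite (S.QuotRing j) := S.finite_quotRing hy j
  haveI := S.isLocalRing_quotRing hy hj
  have hprinc : (IsLocalRing.maximalIdeal (S.QuotRing j)).IsPrincipal :=
    ⟨Ideal.Quotient.mk _ S.π, by rw [S.maximalIdeal_quotRing hy hj, Ideal.submodule_span_eq]⟩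
  exact exists_addMonoidHom_zmod_bijective_mul_compr₂ hprinc (S.natCast_pow_smul_quotRing_eq_zero hk')

/-- The `ℤ_p`-semilinearity of ANY additive character of `R/π^j` (`p^{k'} ∈ (π^j)`), the binder `hlam` of the
reading files at the refined levels. [cite: Howard2004HeegnerKolyvagin, §1.3 H.4 (arXiv:1202.6340 p. 7 L78–82)] -/
theorem apply_algebraMap_mul_quotRing (S : DVRSetting p K R N Rk Nbar Nq) {j k' : ℕ}
    (hk' : ((p : ℕ) : R) ^ k' ∈ Ideal.span {S.π ^ j}) (lam : S.QuotRing j →+ ZMod (p ^ k')) (z : ℤ_[p])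
    (r : S.QuotRing j) :
    lam (algebraMap ℤ_[p] (S.QuotRing j) z * r) = PadicInt.toZModPow k' z * lam r :=
  apply_algebraMap_mul_eq_toZModPow_mul (S.natCast_pow_smul_quotRing_eq_zero hk') lam z r

end DVRSetting

end DVR

end Literature.NumberTheory.GaloisCohomology.Howard2004

end
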